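import Mathlib
import Literature.Analysis.FluidPDE.GigaMiura2011ScaledAlignmentBlowupLimitHolds
import Literature.Analysis.FluidPDE.SteadyNSBoundedMild
import Literature.Analysis.FluidPDE.SteadyNSBoundedAnalytic
import Literature.Analysis.FluidPDE.EnstrophySplitting
import Literature.Analysis.FluidPDE.WholeSpaceIBP
import HarnessLib

/-!
# Census row S7 (bounded steady flows in the periodic slab, case (d)): derivative bounds for
# bounded steady flows and the differentiated steady system

Support file for the scenario census of `NavierStokesRegularity` (cell `pub/ns-census`, row S7 =
Bang–Gui–Wang–Xie 2025, Thm 1.4 (d); tree FACT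
`Literature.Analysis.FluidPDE.BangGuiWangXie2025_periodicSlab_liouville`, second conjunct). Two
inputs of the printed proof (arXiv:2205.13259, §5 Step 4) are supplied here BY NAME from landed
tree theorems:

* **"Lemma (bounded-gradient)"** — a bounded smooth steady Navier–Stokes flow on `ℝ³` has bounded
  derivatives of every order (`steady_exists_norm_iteratedFDeriv_le`): the constant-in-time field is
  a bounded continuous Oseen-mild ancient field
  (`Literature.Analysis.FluidPDE.IsSteadyClassicalNS.eq_heatExtension_sub_oseenDuhamel`, KNSS 2009
  §4 (ii) / Lemma 3.1 for steady fields), to which the uniform window bound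
  `Literature.Analysis.FluidPDE.exists_norm_iteratedFDeriv_le_of_bounded_oseenMild` (KNSS 2009,
  Prop. 4.1 / (4.10)) applies; general viscosity by the scaling
  `Literature.Analysis.FluidPDE.IsSteadyClassicalNS.smul`. Consequences packaged for the census
  proof: `steady_derivative_bounds` (`‖DU‖`, `‖D²U‖`, `‖∇P‖` bounded).
* **"Taking the `x₃`-derivative of the momentum equation"** (`(6-1)` of the source) — for a smooth
  steady solution `(U, P)` and any direction `e`, the pair `w = DU(·)e`, `q = DP(·)e` is smooth,
  divergence free and solves the linearised system
  `ν Δw = (w·∇)U + (U·∇)w + ∇q` (`steady_differentiated_system`; Schwarz's theorem via the tree's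
  `fderiv_fderiv_apply_comm_of_contDiff_two`, `fderiv_laplacian_apply_of_contDiff_three`).

No summit statement and no census row is proved in this file.

## References

* J. Bang, C. Gui, Y. Wang, C. Xie, J. Fluid Mech. 1005 (2025) A6 = arXiv:2205.13259, §5 Step 4
  (Lemma "bounded-gradient" and (6-1)). [BangGuiWangXie2025]
* G. Koch, N. Nadirashvili, G. Seregin, V. Šverák, Acta Math. 203 (2009) = arXiv:0709.3599, §4
  (Prop. 4.1, (4.10)). [KochNadirashviliSereginSverak2009]
-/

-- the summit and its single problem share the name (D-0017 nested layout)
set_option linter.dupNamespace false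

noncomputable section

open MeasureTheory Set Function Filter InnerProductSpace
open scoped Topology ENNReal NNReal RealInnerProductSpace Laplacian ContDiff

namespace Summit.NavierStokesRegularity.NavierStokesRegularity.Theorems.ScenarioCensus.PeriodicSlab

open Literature.Analysis Literature.Analysis.FluidPDE

/-! ### From the profile structure to the steady classical structure -/

/-- A smooth Leray profile at rate `a = 0` is a steady classical Navier–Stokes solution (the two
tree vocabularies `IsLerayProfile ν 0` / `IsSteadyClassicalNS ν 0` agree field by field; converse
of `Literature.Analysis.FluidPDE.IsSteadyClassicalNS.isLerayProfile_zero`). -/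
theorem isSteadyClassicalNS_of_isLerayProfile {ν : ℝ}
    {U : EuclideanSpace ℝ (Fin 3) → EuclideanSpace ℝ (Fin 3)} {P : EuclideanSpace ℝ (Fin 3) → ℝ}
    (h : IsLerayProfile ν 0 U P) (hU : ContDiff ℝ (⊤ : ℕ∞) U) (hP : ContDiff ℝ (⊤ : ℕ∞) P) :
    IsSteadyClassicalNS ν 0 U P where
  smooth_velocity := hU
  smooth_pressure := hP
  momentum x := by
    have h1 := h.profile_eq x
    simp only [zero_smul, add_zero] at h1
    rw [Pi.zero_apply, add_zero]
    -- `h1 : -(ν • Δ U x) + convect U U x + gradient P x = 0`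
    have : convect U U x = ν • (Δ U) x - gradient P x := by
      rw [eq_sub_iff_add_eq]
      have h2 := congrArg (fun z => z + ν • (Δ U) x) h1
      simp only [zero_add] at h2
      rw [← h2]; abel
    exact this
  divFree := h.divFree

/-! ### Bounded steady flows have bounded derivatives of all orders -/

/-- A bounded steady classical flow at unit viscosity, viewed as the constant family `t ↦ W`, is
a continuous Oseen-mild ancient field on `(A, 0)` for every `A`:
`W = e^{(t−s)Δ}W − B¹ₛ(W, W)(t)` for `A < s < t < 0` (tree:
`IsSteadyClassicalNS.eq_heatExtension_sub_oseenDuhamel` with `τ = t − s`, and the time translation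
`oseenDuhamel_translate`). -/
theorem steady_oseenMild_identity
    {W : EuclideanSpace ℝ (Fin 3) → EuclideanSpace ℝ (Fin 3)} {P : EuclideanSpace ℝ (Fin 3) → ℝ}
    (h : IsSteadyClassicalNS 1 0 W P) {M : ℝ} (hM : ∀ x, ‖W x‖ ≤ M) (s t : ℝ) (hst : s < t)
    (x : EuclideanSpace ℝ (Fin 3)) :
    W x = UnboundedOperators.heatExtension W (t - s) x -
      oseenDuhamel 1 s (fun _ : ℝ => W) (fun _ : ℝ => W) t x := by
  rw [h.eq_heatExtension_sub_oseenDuhamel hM (sub_pos.2 hst) x]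
  have h2 := oseenDuhamel_translate 1 0 s (fun _ : ℝ => W) (fun _ : ℝ => W) (t - s) x
  simp only [zero_add, sub_add_cancel] at h2
  rw [h2]

/-- **Bounded steady flows have bounded derivatives of all orders** (unit viscosity): for a
steady classical solution `(W, P)` of unforced Navier–Stokes on `ℝ³` with `‖W‖ ≤ M` and every
`k`, `sup_x ‖DᵏW(x)‖ < ∞` (KNSS 2009, (4.10), through the tree's uniform window bound for bounded
Oseen-mild fields, applied to the constant-in-time field on the window `[−3/2, −1) ⊂ (−2, −1)`). -/
theorem steady_exists_norm_iteratedFDeriv_le_one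
    {W : EuclideanSpace ℝ (Fin 3) → EuclideanSpace ℝ (Fin 3)} {P : EuclideanSpace ℝ (Fin 3) → ℝ}
    (h : IsSteadyClassicalNS 1 0 W P) {M : ℝ} (hM : ∀ x, ‖W x‖ ≤ M) (k : ℕ) :
    ∃ K : ℝ, ∀ x, ‖iteratedFDeriv ℝ k W x‖ ≤ K := by
  obtain ⟨K, hK⟩ := exists_norm_iteratedFDeriv_le_of_bounded_oseenMild M k (ℓ := 1) (δ := 2⁻¹)
    one_pos (by norm_num)
  refine ⟨K, fun x => ?_⟩
  have hWc : Continuous W := h.smooth_velocity.continuous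
  have h1 := hK (A := -3) (a := -2) (u := fun _ : ℝ => W) (by norm_num) (by norm_num)
    ((hWc.comp continuous_snd).continuousOn)
    (fun t _ => VectorCalculus.IsDivFree.isWeaklyDivFree_holds h.divFree
      (contDiff_infty.1 h.smooth_velocity 1))
    (fun s t _ hst _ y => steady_oseenMild_identity h hM s t hst y)
    (fun t _ y => hM y) (-3 / 2) ⟨by norm_num, by norm_num⟩ x
  exact h1

/-- **Bounded steady flows have bounded derivatives of all orders**, any viscosity `ν > 0`
(scaling `(W, P) ↦ (ν⁻¹W, ν⁻²P)` to unit viscosity, `IsSteadyClassicalNS.smul`). -/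
theorem steady_exists_norm_iteratedFDeriv_le {ν : ℝ} (hν : 0 < ν)
    {W : EuclideanSpace ℝ (Fin 3) → EuclideanSpace ℝ (Fin 3)} {P : EuclideanSpace ℝ (Fin 3) → ℝ}
    (h : IsSteadyClassicalNS ν 0 W P) {M : ℝ} (hM : ∀ x, ‖W x‖ ≤ M) (k : ℕ) :
    ∃ K : ℝ, ∀ x, ‖iteratedFDeriv ℝ k W x‖ ≤ K := by
  have h1 : IsSteadyClassicalNS 1 0 (ν⁻¹ • W) (ν⁻¹ ^ 2 • P) := by
    simpa [inv_mul_cancel₀ hν.ne'] using h.smul ν⁻¹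
  have hb : ∀ x, ‖(ν⁻¹ • W) x‖ ≤ |ν⁻¹| * M := fun x => by
    rw [Pi.smul_apply, norm_smul, Real.norm_eq_abs]
    exact mul_le_mul_of_nonneg_left (hM x) (abs_nonneg _)
  obtain ⟨K, hK⟩ := steady_exists_norm_iteratedFDeriv_le_one h1 hb k
  refine ⟨ν * K, fun x => ?_⟩
  have hW : W = ν • (ν⁻¹ • W) := by rw [smul_smul, mul_inv_cancel₀ hν.ne', one_smul]
  have hsm : ContDiff ℝ k (ν⁻¹ • W) := contDiff_infty.1 h1.smooth_velocity k
  have e : iteratedFDeriv ℝ k W x = ν • iteratedFDeriv ℝ k (ν⁻¹ • W) x := by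
    conv_lhs => rw [hW]
    exact iteratedFDeriv_const_smul_apply hsm.contDiffAt
  rw [e, norm_smul, Real.norm_of_nonneg hν.le]
  exact mul_le_mul_of_nonneg_left (hK x) hν.le

/-! ### Pointwise consequences: `DU`, `D²U`, `ΔU`, `∇P` -/

/-- **Derivative bounds for a bounded smooth steady flow** (`ν > 0`): there are constants with
`‖DU(x)‖ ≤ K₁`, `‖D²U(x)‖ ≤ K₂` and `‖∇P(x)‖ ≤ K₃` for all `x` (the pressure gradient through
the momentum equation `∇P = νΔU − (U·∇)U`). -/
theorem steady_derivative_bounds {ν : ℝ} (hν : 0 < ν)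
    {U : EuclideanSpace ℝ (Fin 3) → EuclideanSpace ℝ (Fin 3)} {P : EuclideanSpace ℝ (Fin 3) → ℝ}
    (h : IsSteadyClassicalNS ν 0 U P) {M : ℝ} (hM : ∀ x, ‖U x‖ ≤ M) :
    ∃ K₁ K₂ K₃ : ℝ, 0 ≤ K₁ ∧ 0 ≤ K₂ ∧ 0 ≤ K₃ ∧ ∀ x,
      ‖fderiv ℝ U x‖ ≤ K₁ ∧ ‖iteratedFDeriv ℝ 2 U x‖ ≤ K₂ ∧ ‖gradient P x‖ ≤ K₃ := by
  obtain ⟨K₁, hK₁⟩ := steady_exists_norm_iteratedFDeriv_le hν h hM 1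
  obtain ⟨K₂, hK₂⟩ := steady_exists_norm_iteratedFDeriv_le hν h hM 2
  have hK₁0 : 0 ≤ K₁ := (norm_nonneg _).trans (hK₁ 0)
  have hK₂0 : 0 ≤ K₂ := (norm_nonneg _).trans (hK₂ 0)
  have hM0 : 0 ≤ M := (norm_nonneg _).trans (hM 0)
  -- `‖ΔU(x)‖ ≤ 3 ‖D²U(x)‖` (the Laplacian as a trace over an orthonormal frame; cf. the tree's
  -- `norm_laplacian_le_three_mul_iteratedFDeriv`, not imported to keep the closure small)
  have hlap : ∀ x, ‖(Δ U) x‖ ≤ 3 * K₂ := fun x => by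
    set b := stdOrthonormalBasis ℝ (EuclideanSpace ℝ (Fin 3)) with hb
    rw [InnerProductSpace.laplacian_eq_iteratedFDeriv_orthonormalBasis U b]
    calc ‖∑ i, iteratedFDeriv ℝ 2 U x ![b i, b i]‖ ≤ ∑ i, ‖iteratedFDeriv ℝ 2 U x ![b i, b i]‖ :=
          norm_sum_le _ _
      _ ≤ ∑ _i : Fin (Module.finrank ℝ (EuclideanSpace ℝ (Fin 3))), K₂ :=
          Finset.sum_le_sum fun i _ => by
            refine (ContinuousMultilinearMap.le_opNorm _ _).trans ?_
            rw [Fin.prod_univ_two]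
            simp only [Matrix.cons_val_zero, Matrix.cons_val_one, b.orthonormal.1 i, mul_one]
            exact hK₂ x
      _ = 3 * K₂ := by simp [Finset.sum_const, Finset.card_univ, finrank_euclideanSpace]
  have hD : ∀ x, ‖fderiv ℝ U x‖ ≤ K₁ := fun x => by
    rw [← norm_iteratedFDeriv_zero (𝕜 := ℝ) (f := fderiv ℝ U), norm_iteratedFDeriv_fderiv]
    exact hK₁ x
  refine ⟨K₁, K₂, ν * (3 * K₂) + K₁ * M, hK₁0, hK₂0, by positivity, fun x => ⟨hD x, hK₂ x, ?_⟩⟩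
  have hm := h.momentum x
  rw [Pi.zero_apply, add_zero] at hm
  have hgrad : gradient P x = ν • (Δ U) x - convect U U x := by rw [hm]; abel
  rw [hgrad]
  refine (norm_sub_le _ _).trans (add_le_add ?_ ?_)
  · rw [norm_smul, Real.norm_of_nonneg hν.le]
    exact mul_le_mul_of_nonneg_left (hlap x) hν.le
  · rw [convect_apply]
    exact (ContinuousLinearMap.le_opNorm _ _).trans (mul_le_mul (hD x) (hM x) (norm_nonneg _) hK₁0)

/-! ### The differentiated steady system -/

/-- **The differentiated steady system.** Let `(U, P)` be a steady classical solution of unforced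
Navier–Stokes with viscosity `ν` on `ℝ³` and let `e` be a fixed vector. Then the directional
derivatives `w = DU(·)e`, `q = DP(·)e` are smooth, `w` is divergence free, and
`ν Δw = (w·∇)U + (U·∇)w + ∇q` pointwise (differentiate `(U·∇)U = νΔU − ∇P` along `e`; all mixed
partials commute by Schwarz's theorem). This is equation (6-1) of Bang–Gui–Wang–Xie, §5 Step 4,
for `e = e₃`. -/
theorem steady_differentiated_system {ν : ℝ}
    {U : EuclideanSpace ℝ (Fin 3) → EuclideanSpace ℝ (Fin 3)} {P : EuclideanSpace ℝ (Fin 3) → ℝ}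
    (h : IsSteadyClassicalNS ν 0 U P) (e : EuclideanSpace ℝ (Fin 3)) :
    ContDiff ℝ (⊤ : ℕ∞) (fun y => fderiv ℝ U y e) ∧ ContDiff ℝ (⊤ : ℕ∞) (fun y => fderiv ℝ P y e) ∧
      VectorCalculus.IsDivFree (fun y => fderiv ℝ U y e) ∧
      ∀ x, ν • (Δ (fun y => fderiv ℝ U y e)) x =
        convect (fun y => fderiv ℝ U y e) U x + convect U (fun y => fderiv ℝ U y e) x +
          gradient (fun y => fderiv ℝ P y e) x := by
  set w : EuclideanSpace ℝ (Fin 3) → EuclideanSpace ℝ (Fin 3) := fun y => fderiv ℝ U y e with hw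
  set q : EuclideanSpace ℝ (Fin 3) → ℝ := fun y => fderiv ℝ P y e with hq
  set b := EuclideanSpace.basisFun (Fin 3) ℝ with hb
  have hU : ContDiff ℝ ∞ U := h.smooth_velocity
  have hP : ContDiff ℝ ∞ P := h.smooth_pressure
  have hU2 : ContDiff ℝ 2 U := contDiff_infty.1 hU 2
  have hU3 : ContDiff ℝ 3 U := contDiff_infty.1 hU 3
  have hP2 : ContDiff ℝ 2 P := contDiff_infty.1 hP 2
  have hwS : ContDiff ℝ ∞ w := (hU.fderiv_right (m := ∞) le_rfl).clm_apply contDiff_const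
  have hqS : ContDiff ℝ ∞ q := (hP.fderiv_right (m := ∞) le_rfl).clm_apply contDiff_const
  have hUd : ∀ x, DifferentiableAt ℝ U x := fun x => (hU.differentiable (by simp)) x
  have hDUd : ∀ x, DifferentiableAt ℝ (fderiv ℝ U) x := fun x =>
    ((hU2.fderiv_right (m := 1) le_rfl).differentiable one_ne_zero) x
  have hpart : ∀ a : EuclideanSpace ℝ (Fin 3), ContDiff ℝ ∞ (fun y => fderiv ℝ U y a) := fun a =>
    (hU.fderiv_right (m := ∞) le_rfl).clm_apply contDiff_const
  have hpartd : ∀ (a x : EuclideanSpace ℝ (Fin 3)), DifferentiableAt ℝ (fun y => fderiv ℝ U y a) x :=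
    fun a x => ((hpart a).differentiable (by simp)) x
  -- Schwarz
  have hsymmU : ∀ (x v₁ v₂ : EuclideanSpace ℝ (Fin 3)),
      fderiv ℝ (fderiv ℝ U) x v₁ v₂ = fderiv ℝ (fderiv ℝ U) x v₂ v₁ := fun x v₁ v₂ =>
    (hU2.contDiffAt.isSymmSndFDerivAt (by simp)) v₁ v₂
  refine ⟨hwS, hqS, ?_, ?_⟩
  · -- `div w = 0`
    intro x
    have hdivU : (fun y => VectorCalculus.divergence U y) = fun _ => (0 : ℝ) := funext h.divFree
    have e1 : VectorCalculus.divergence w x = ∑ i, ⟪b i, fderiv ℝ (fun y => fderiv ℝ U y (b i)) x e⟫ := by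
      rw [divergence_eq_sum_inner_fderiv b w x]
      refine Finset.sum_congr rfl fun i _ => ?_
      rw [hw, fderiv_fderiv_apply_comm_of_contDiff_two hU2 x e (b i)]
    have e2 : fderiv ℝ (fun y => VectorCalculus.divergence U y) x e =
        ∑ i, ⟪b i, fderiv ℝ (fun y => fderiv ℝ U y (b i)) x e⟫ := by
      have hfun : (fun y => VectorCalculus.divergence U y) =
          fun y => ∑ i, ⟪b i, fderiv ℝ U y (b i)⟫ := funext fun y => divergence_eq_sum_inner_fderiv b U y
      have hterm : ∀ i, DifferentiableAt ℝ (fun y => ⟪b i, fderiv ℝ U y (b i)⟫) x := fun i =>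
        (differentiableAt_const _).inner ℝ (hpartd (b i) x)
      rw [hfun, fderiv_fun_sum fun i _ => hterm i, FunLike.coe_sum, Finset.sum_apply]
      refine Finset.sum_congr rfl fun i _ => ?_
      rw [fderiv_inner_apply ℝ (differentiableAt_const _) (hpartd (b i) x)]
      simp
    rw [e1, ← e2, hdivU]
    simp
  · -- the momentum equation differentiated along `e`
    intro x
    -- the three maps and their derivatives along `e`
    have hm : ∀ y, convect U U y = ν • (Δ U) y - gradient P y := fun y => by
      have := h.momentum y; rwa [Pi.zero_apply, add_zero] at this
    -- (1) convection: `D[(U·∇)U](x) e = (w·∇)U + D²U(x)(e)(U x)`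
    have hconv : fderiv ℝ (fun y => convect U U y) x e =
        convect w U x + fderiv ℝ (fderiv ℝ U) x e (U x) := by
      have : (fun y => convect U U y) = fun y => (fderiv ℝ U y) (U y) := funext fun y => convect_apply U U y
      rw [this, fderiv_clm_apply (hDUd x) (hUd x)]
      simp [convect_apply, hw]
    have hconv' : fderiv ℝ (fderiv ℝ U) x e (U x) = convect U w x := by
      rw [convect_apply, hw, fderiv_apply_const_apply (hDUd x) e (U x), hsymmU]
    -- (2) Laplacian: `D[ΔU](x) e = Δw(x)`
    have hΔfun : (Δ U) = fun y => ∑ i, fderiv ℝ (fun z => fderiv ℝ U z (b i)) y (b i) :=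
      funext fun y => laplacian_eq_sum_fderiv_fderiv b hU2 y
    have hΔd : DifferentiableAt ℝ (Δ U) x := by
      rw [hΔfun]
      refine DifferentiableAt.fun_sum fun i _ => ?_
      exact ((((hpart (b i)).fderiv_right (m := ∞) le_rfl).clm_apply contDiff_const).differentiable
        (by simp)) x
    have hlap : fderiv ℝ (Δ U) x e = (Δ w) x := fderiv_laplacian_apply_of_contDiff_three hU3 x e
    -- (3) pressure: `⟪D[∇P](x) e, v⟫ = ⟪∇q(x), v⟫` through the scalar `y ↦ DP(y) v`
    have hgradfun : (fun y => gradient P y) = fun y => ν • (Δ U) y - convect U U y :=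
      funext fun y => by rw [hm y]; abel
    have hconvd : DifferentiableAt ℝ (fun y => convect U U y) x := by
      have : (fun y => convect U U y) = fun y => (fderiv ℝ U y) (U y) := funext fun y => convect_apply U U y
      rw [this]; exact (hDUd x).clm_apply (hUd x)
    have hgradd : DifferentiableAt ℝ (fun y => gradient P y) x := by
      have hsd : DifferentiableAt ℝ (fun y => ν • (Δ U) y) x := hΔd.const_smul ν
      rw [hgradfun]; exact hsd.sub hconvd
    have hpress : ∀ v : EuclideanSpace ℝ (Fin 3),
        ⟪fderiv ℝ (fun y => gradient P y) x e, v⟫ = ⟪gradient q x, v⟫ := by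
      intro v
      -- `⟪∇P y, v⟫ = DP(y) v`
      have hs : (fun y => ⟪gradient P y, v⟫) = fun y => fderiv ℝ P y v := funext fun y => by
        rw [gradient, InnerProductSpace.toDual_symm_apply]
      have h1 : fderiv ℝ (fun y => ⟪gradient P y, v⟫) x e = ⟪fderiv ℝ (fun y => gradient P y) x e, v⟫ := by
        rw [fderiv_inner_apply ℝ hgradd (differentiableAt_const v)]
        simp
      have h2 : fderiv ℝ (fun y => fderiv ℝ P y v) x e = fderiv ℝ q x v := by
        rw [hq]
        exact fderiv_fderiv_apply_comm_of_contDiff_two hP2 x v e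
      rw [← h1, hs, h2, gradient, InnerProductSpace.toDual_symm_apply]
    -- assemble: differentiate `convect U U = ν • ΔU − ∇P` along `e` and test against `v`
    have hderiv : fderiv ℝ (fun y => convect U U y) x e =
        ν • fderiv ℝ (Δ U) x e - fderiv ℝ (fun y => gradient P y) x e := by
      have hfun : (fun y => convect U U y) = fun y => ν • (Δ U) y - gradient P y := funext hm
      have hsd : DifferentiableAt ℝ (fun y => ν • (Δ U) y) x := hΔd.const_smul ν
      rw [hfun, fderiv_fun_sub hsd hgradd, fderiv_fun_const_smul hΔd]
      rfl
    refine ext_inner_right ℝ fun v => ?_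
    have key := congrArg (fun z => ⟪z, v⟫) hderiv
    simp only [inner_sub_left, inner_add_left] at key ⊢
    rw [hconv, inner_add_left, hconv', hlap, inner_smul_left, hpress] at key
    simp only [RCLike.conj_to_real] at key
    rw [inner_smul_left]
    simp only [RCLike.conj_to_real]
    linarith

end Summit.NavierStokesRegularity.NavierStokesRegularity.Theorems.ScenarioCensus.PeriodicSlab

end
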